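import Summits.ResolutionOfSingularities.ResolutionOfSingularities.Theorems.HomologicalConductorNoZenoRTopFactorisation
import Summits.ResolutionOfSingularities.ResolutionOfSingularities.Theorems.HomologicalConductorNoZenoRDescent
import Summits.ResolutionOfSingularities.ResolutionOfSingularities.Theorems.HomologicalConductorNoZenoRCountCriterion
import Summits.ResolutionOfSingularities.ResolutionOfSingularities.Theorems.HomologicalConductorNoZenoRRelativelyMinimalCriterion
import Summits.ResolutionOfSingularities.ResolutionOfSingularities.Theorems.HomologicalConductorNoZenoRCommonDomination
import HarnessLib

/-!
# Crux `NoZenoR` (stmt-ResolutionOfSingularities-19943) — Lipman (27.3) «⇐» WITHOUT Theorem (4.1):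
# criterion (M) ⇒ minimal, MODULO the one-step intersection exercise of p. 278; hence the existence of the minimal
# desingularization of `Spec S` from (27.1) + the exercise

Route `ResolutionOfSingularities/HomologicalConductor` (cell decomp-res, hand leafhand-res-homologicalconduct-18 g1).
OURS: AI-written proof over tree theorems, weaker than expert review; nothing here is a statement of the manuscript
under review (Hironaka 2017).  SUPPORT level, counted 0.  Def-free, no new named facts; FACT-PARAMETRIC in the
explicit binder `hex` (Lipman p. 278: «(E·E)+χ(E) = (E′·E′)+χ(E′) ≥ (E*·E*)+χ(E*)» for one quadratic transformation,
in the form «(M) passes to the strict transform») and, where stated, in `Lipman1969_27_1_reg_rat`.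

Lipman's proof of (27.3), second paragraph, verbatim on the tree: `X` satisfies (M), `Z₁` any desingularization; take
`W` dominating both (`Lipman12B.exists_isPointBlowupComposition_dominating_of_ringKrullDim_le_two`) with the FEWEST
exceptional curves; if `W → Z₁` is not an isomorphism, split off its top quadratic transformation `τ : W′ → W₁`
(`exists_top_fac`), `F` its exceptional curve (first kind).  If `W′ → X` contracts `F`, it DESCENDS to `W₁`
(`exists_desc_of_contracts`) and `W₁` dominates both with fewer curves — contradiction; otherwise `F` is the strict
transform of an exceptional curve `E` of `X`, and (M) at `E` passes to `F` (`criterionM_transfer_of_hex`) — against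
`(F·F) = −h⁰(F)`.

* **`isMinimalResolution_of_criterionM_of_hex`** — (M) ⇒ `IsMinimalResolution`, modulo `hex`;
* `exists_isMinimalResolution_of_27_1_of_hex` — `Spec S` HAS a minimal desingularization, from (27.1) + `hex`
  (the relatively minimal model satisfies (M), `exists_criterionM_of_27_1`);
* `Lipman1969_27_3_rat_of_27_1_of_hex` — the named fact (27.3) (universe 0) from (27.1) + `hex`.

No crux or summit statement is proved here.
-/

noncomputable section

-- single-problem summit: the doubled namespace component `ResolutionOfSingularities` is forced
set_option linter.dupNamespace false

open CategoryTheory AlgebraicGeometry TopologicalSpace Topology IsLocalRing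
open Literature.AlgebraicGeometry.Resolution
open Scheme.IdealSheafData
open Summit.ResolutionOfSingularities.ResolutionOfSingularities.Theorems.NoZeno.ExcCount
open Summit.ResolutionOfSingularities.ResolutionOfSingularities.Theorems.NoZeno.ExcCount.FirstKind

namespace Summit.ResolutionOfSingularities.ResolutionOfSingularities.Theorems.NoZeno.FirstKind

variable {S : Type} [CommRing S] [IsNoetherianRing S] [IsLocalRing S] [IsDomain S] [IsIntegrallyClosed S]

/-- **Lipman (27.3) «⇐» without (4.1): criterion (M) ⇒ minimal, modulo the one-step exercise `hex`.**  For `S` a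
two-dimensional Noetherian local normal domain and a desingularization `π : X → Spec S` with `3·h⁰(𝓘_η) < h⁰(𝓘_η²)`
for every integral exceptional curve: every desingularization of `Spec S` factors through `π`.
[cite: Lipman1969, Corollary (27.3) (p. 277; proof pp. 277–278)] -/
theorem isMinimalResolution_of_criterionM_of_hex (h2 : ringKrullDim S = 2)
    (hex : ∀ ⦃Y : Scheme.{0}⦄ (g : Y ⟶ Spec (.of S)), IsResolution g →
      ∀ ⦃y : Y⦄ (hy : IsClosed ({y} : Set Y)), ringKrullDim (Y.presheaf.stalk y) = 2 →
      ∀ ⦃Y₁ : Scheme.{0}⦄ (b : Y₁ ⟶ Y), IsBlowup b (vanishingIdeal ⟨{y}, hy⟩) →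
      ∀ ⦃η₁ : Y₁⦄, η₁ ∈ excCurvePoints (b ≫ g) → b.base η₁ ∈ excCurvePoints g →
        3 * h0 g (primeDivisorIdeal (b.base η₁)) < h0 g (primeDivisorIdeal (b.base η₁) ^ 2) →
        3 * h0 (b ≫ g) (primeDivisorIdeal η₁) < h0 (b ≫ g) (primeDivisorIdeal η₁ ^ 2))
    {X : Scheme.{0}} {π : X ⟶ Spec (.of S)} (hπ : IsResolution π)
    (hM : ∀ η ∈ excCurvePoints π, 3 * h0 π (primeDivisorIdeal η) < h0 π (primeDivisorIdeal η ^ 2)) :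
    IsMinimalResolution π := by
  haveI : IsIntegral X := hπ.isIntegral_source
  haveI : IsProper π := hπ.isProper
  -- P(n): every `Z₁` dominated, together with `X`, by some `W` with at most `n` exceptional curves factors through `π`
  suffices H : ∀ (n : ℕ) (W Z₁ : Scheme.{0}) (g₁ : Z₁ ⟶ Spec (.of S)) (j : W ⟶ Z₁) (q : W ⟶ X),
      IsResolution g₁ → IsResolution (j ≫ g₁) → q ≫ π = j ≫ g₁ → (excCurvePoints (j ≫ g₁)).ncard ≤ n →
      ∃ k : Z₁ ⟶ X, k ≫ π = g₁ by
    refine ⟨hπ, fun Z₁ g₁ hg₁ => ?_⟩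
    haveI : IsIntegral Z₁ := hg₁.isIntegral_source
    obtain ⟨W, j, q, -, -, hj, hfac⟩ :=
      Lipman12B.exists_isPointBlowupComposition_dominating_of_ringKrullDim_le_two h2.le g₁ hg₁ π hπ.isBirational
    exact H _ W Z₁ g₁ j q hg₁ (isResolution_comp_of_isResolution hj hg₁) hfac le_rfl
  intro n
  induction n with
  | zero =>
    intro W Z₁ g₁ j q hg₁ hjg hfac hle
    by_cases hj : IsIso j
    · exact ⟨inv j ≫ q, by rw [Category.assoc, hfac, IsIso.inv_hom_id_assoc]⟩
    · have := ncard_excCurvePoints_succ_le_of_not_isIso h2 hjg hg₁ rfl hj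
      omega
  | succ n ih =>
    intro W Z₁ g₁ j q hg₁ hjg hfac hle
    by_cases hj : IsIso j
    · exact ⟨inv j ≫ q, by rw [Category.assoc, hfac, IsIso.inv_hom_id_assoc]⟩
    -- split off the top quadratic transformation of `j`
    obtain ⟨W₁, ρ₁, σ, x', hx', W', τ, e, he, hρ₁, hσ, hx'2, hτ, hτρ₁, hjfac⟩ :=
      exists_top_fac h2 hjg Z₁ g₁ j hg₁ rfl hj
    haveI : IsIntegral W₁ := hρ₁.isIntegral_source
    haveI : IsIntegral W' := hτρ₁.isIntegral_source
    haveI : IsProper ρ₁ := hρ₁.isProper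
    haveI : IsLocallyNoetherian W₁ := LocallyOfFiniteType.isLocallyNoetherian ρ₁
    haveI : IsRegularLocalRing (W₁.presheaf.stalk x') := hρ₁.isRegular x'
    -- `q' : W' → X` and its structure equation
    set q' : W' ⟶ X := inv e ≫ q with hq'def
    have hq' : q' ≫ π = τ ≫ ρ₁ := by
      rw [hq'def, Category.assoc, hfac, ← hjfac]
      simp only [Category.assoc, IsIso.inv_hom_id_assoc, hσ]
    have hq'res : IsResolution (q' ≫ π) := by rw [hq']; exact hτρ₁
    -- the exceptional curve `F = cl{ε}` of `τ`, of the first kind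
    obtain ⟨ε, hε, hcl, hId⟩ := exists_mem_excCurvePoints_blowup_point h2 ρ₁ hρ₁ hx' hx'2 τ hτ hτρ₁
    have hfirst : h0 (τ ≫ ρ₁) (primeDivisorIdeal ε ^ 2) = 3 * h0 (τ ≫ ρ₁) (primeDivisorIdeal ε) := by
      rw [hId]
      exact PointBlowup.h0_comap_vanishingIdeal_point_sq_eq_three_mul ρ₁ τ x' hx' hx'2 hτ
    by_cases hclosed : IsClosed ({q'.base ε} : Set X)
    · -- Case B: `q'` contracts `F`; it descends to `W₁`, which dominates both with fewer curves
      have hcontr : ∀ w : W', τ.base w = x' → q'.base w = q'.base ε := by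
        intro w hw
        have hwcl : w ∈ closure ({ε} : Set W') := by rw [hcl]; exact hw
        have : q'.base w ∈ closure ({q'.base ε} : Set X) := by
          have := image_closure_subset_closure_image q'.continuous ⟨w, hwcl, rfl⟩
          rwa [Set.image_singleton] at this
        rwa [hclosed.closure_eq, Set.mem_singleton_iff] at this
      -- `τ` is an isomorphism off `x'`
      have hU : (⟨((vanishingIdeal (⟨{x'}, hx'⟩ : Closeds W₁)).support : Set W₁)ᶜ,
          (vanishingIdeal (⟨{x'}, hx'⟩ : Closeds W₁)).support.isClosed.isOpen_compl⟩ : W₁.Opens) =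
          ⟨{x'}ᶜ, hx'.isOpen_compl⟩ :=
        TopologicalSpace.Opens.ext (by
          rw [TopologicalSpace.Opens.coe_mk, TopologicalSpace.Opens.coe_mk,
            Scheme.IdealSheafData.coe_support_vanishingIdeal]; rfl)
      haveI : IsIso (τ ∣_ (⟨{x'}ᶜ, hx'.isOpen_compl⟩ : W₁.Opens)) :=
        ((MorphismProperty.isomorphisms Scheme).arrow_mk_iso_iff (morphismRestrictEq τ hU)).mp hτ.isIso_compl
      obtain ⟨q₁, hq₁⟩ := exists_desc_of_contracts hρ₁ hτρ₁ q' hx' hcontr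
      -- `q₁ ≫ π = ρ₁ = σ ≫ g₁` (cancel `τ` on global sections: maps into the affine `Spec S`)
      have hq₁π : q₁ ≫ π = ρ₁ := by
        haveI h1 : IsIso (τ ≫ ρ₁).appTop := hτρ₁.isIso_appTop
        haveI h2' : IsIso ρ₁.appTop := hρ₁.isIso_appTop
        haveI : IsIso τ.appTop := by
          rw [Scheme.Hom.comp_appTop] at h1
          exact IsIso.of_isIso_comp_left ρ₁.appTop τ.appTop
        refine ext_of_isAffine ?_
        rw [← cancel_mono τ.appTop, ← Scheme.Hom.comp_appTop, ← Scheme.Hom.comp_appTop, ← Category.assoc, hq₁,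
          hq']
      -- count: `#exc ρ₁ + 1 ≤ #exc (τ ≫ ρ₁) = #exc (j ≫ g₁)`
      have hc2 := ncard_excCurvePoints_blowup_point h2 ρ₁ hρ₁ hx' hx'2 τ hτ hτρ₁
      have heq : (excCurvePoints (j ≫ g₁)).ncard = (excCurvePoints (τ ≫ ρ₁)).ncard := by
        have hres : IsResolution (e ≫ τ ≫ ρ₁) := by
          have h' : e ≫ τ ≫ ρ₁ = j ≫ g₁ := by rw [← hjfac, ← hσ]; simp only [Category.assoc]
          rw [h']; exact hjg
        have := (isIso_iff_ncard_excCurvePoints_eq h2 hres hτρ₁ rfl).mp he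
        rw [← this, ← hjfac, Category.assoc, Category.assoc, hσ]
      have hρ₁' : IsResolution (σ ≫ g₁) := by rw [hσ]; exact hρ₁
      refine ih W₁ Z₁ g₁ σ q₁ hg₁ hρ₁' (by rw [hq₁π, hσ]) ?_
      rw [hσ]; omega
    · -- Case A: `F` is the strict transform of an exceptional curve of `X` satisfying (M): contradiction
      exfalso
      have hover : (q' ≫ π).base ε = closedPoint S := by rw [hq']; exact hε.1
      have hqε : q'.base ε ∈ excCurvePoints π := by
        have hover' : π.base (q'.base ε) = closedPoint S := by rw [← Scheme.Hom.comp_apply]; exact hover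
        refine ⟨hover', le_antisymm (hπ.height_le_one_of_base_eq_closedPoint h2 hover') ?_⟩
        exact Order.one_le_iff_ne_zero.mpr fun h0 => hclosed (isClosed_singleton_of_height_eq_zero' h0)
      have hε' : ε ∈ excCurvePoints (q' ≫ π) := by rw [hq']; exact hε
      have hMε := criterionM_transfer_of_hex h2 hex hπ W' q' hq'res ε hε' hqε (hM _ hqε)
      rw [hq', hfirst] at hMε
      exact lt_irrefl _ hMε

/-- **The minimal desingularization of `Spec S` EXISTS, from (27.1) and the one-step exercise** (no Theorem (4.1)):
the relatively minimal model of `exists_fac_forall_isIso` satisfies (M) under (27.1) (`exists_criterionM_of_27_1`), hence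
is minimal (`isMinimalResolution_of_criterionM_of_hex`). [cite: Lipman1969, Theorem (4.1) (p. 204), Corollary (27.3) (p. 277)] -/
theorem exists_isMinimalResolution_of_27_1_of_hex (h271 : Lipman1969_27_1_reg_rat.{0}) (h2 : ringKrullDim S = 2)
    (hS : HasRationalSingularity S)
    (hex : ∀ ⦃Y : Scheme.{0}⦄ (g : Y ⟶ Spec (.of S)), IsResolution g →
      ∀ ⦃y : Y⦄ (hy : IsClosed ({y} : Set Y)), ringKrullDim (Y.presheaf.stalk y) = 2 →
      ∀ ⦃Y₁ : Scheme.{0}⦄ (b : Y₁ ⟶ Y), IsBlowup b (vanishingIdeal ⟨{y}, hy⟩) →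
      ∀ ⦃η₁ : Y₁⦄, η₁ ∈ excCurvePoints (b ≫ g) → b.base η₁ ∈ excCurvePoints g →
        3 * h0 g (primeDivisorIdeal (b.base η₁)) < h0 g (primeDivisorIdeal (b.base η₁) ^ 2) →
        3 * h0 (b ≫ g) (primeDivisorIdeal η₁) < h0 (b ≫ g) (primeDivisorIdeal η₁ ^ 2)) :
    ∃ (X : Scheme.{0}) (π : X ⟶ Spec (.of S)), IsMinimalResolution π := by
  obtain ⟨X, π, hπ, hMX⟩ := exists_criterionM_of_27_1 h271 h2 hS
  exact ⟨X, π, isMinimalResolution_of_criterionM_of_hex h2 hex hπ hMX⟩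

omit [CommRing S] [IsNoetherianRing S] [IsLocalRing S] [IsDomain S] [IsIntegrallyClosed S] in
/-- **`Lipman1969_27_3_rat` (universe 0) from `Lipman1969_27_1_reg_rat` and the one-step exercise** (no Theorem (4.1)):
«⇒» by (27.1) (`criterionM_of_forall_isIso` on a minimal, hence relatively minimal, desingularization), «⇐» by
`isMinimalResolution_of_criterionM_of_hex`. [cite: Lipman1969, Corollary (27.3) (p. 277), Theorem (27.1) (p. 275)] -/
theorem Lipman1969_27_3_rat_of_27_1_of_hex (h271 : Lipman1969_27_1_reg_rat.{0})
    (hex : ∀ (S : Type) [CommRing S] [IsNoetherianRing S] [IsLocalRing S] [IsDomain S] [IsIntegrallyClosed S],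
      ringKrullDim S = 2 → HasRationalSingularity S →
      ∀ ⦃Y : Scheme.{0}⦄ (g : Y ⟶ Spec (.of S)), IsResolution g →
      ∀ ⦃y : Y⦄ (hy : IsClosed ({y} : Set Y)), ringKrullDim (Y.presheaf.stalk y) = 2 →
      ∀ ⦃Y₁ : Scheme.{0}⦄ (b : Y₁ ⟶ Y), IsBlowup b (vanishingIdeal ⟨{y}, hy⟩) →
      ∀ ⦃η₁ : Y₁⦄, η₁ ∈ excCurvePoints (b ≫ g) → b.base η₁ ∈ excCurvePoints g →
        3 * h0 g (primeDivisorIdeal (b.base η₁)) < h0 g (primeDivisorIdeal (b.base η₁) ^ 2) →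
        3 * h0 (b ≫ g) (primeDivisorIdeal η₁) < h0 (b ≫ g) (primeDivisorIdeal η₁ ^ 2)) :
    Lipman1969_27_3_rat.{0} := by
  intro S _ _ _ _ _ h2 hS X π hπ
  constructor
  · intro hmin
    exact criterionM_of_forall_isIso h271 h2 hS hπ
      (fun Y g k hg hk => isIso_of_isMinimalResolution_of_fac hmin hg k hk)
  · intro hMX
    exact isMinimalResolution_of_criterionM_of_hex h2 (hex S h2 hS) hπ hMX

end Summit.ResolutionOfSingularities.ResolutionOfSingularities.Theorems.NoZeno.FirstKind

end
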